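import Summits.RiemannHypothesis.RiemannHypothesis.Theorems.SoloInformedQuasiWeilExact
import Summits.RiemannHypothesis.RiemannHypothesis.Theorems.SoloInformedQuasiWeilStrip
import Summits.RiemannHypothesis.RiemannHypothesis.Theorems.HandoffWallSequence
import Summits.RiemannHypothesis.RiemannHypothesis.Theorems.SoloInformedEffMain
import Summits.RiemannHypothesis.RiemannHypothesis.Theorems.HandoffLadderRungOne
import Literature.NumberTheory.DiophantineGeometry.NamedHypotheses
import Literature.NumberTheory.LFunctions.RiemannHypothesisUpTo101

/-!
# RiemannHypothesis / Splittings — Weil-negativity rungs I: RATE, THRESHOLD and PER-TEST-FUNCTION axes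
(RAW zero-definition form of cell rh-split, seat (weil, neg) gen 2, card `cards/SPLIT-weil-neg.md` §8)

Kernel bookkeeping over tree theorems only (no new analysis).  Raw form (typer-2 g2) of
`HOME/rh-split-weil-neg/SketchG2.lean` (sha16 d7d5117629c732f7; referee g0 replay 19:34Z std; lead GO item (4)):
the Props `QuasiRH/Strip/RateN/RateL2/SparseOffline/LineZeros` are WRITTEN OUT in every statement (theorems only).
`_root_.RiemannHypothesis` is Mathlib's statement.

* §1 RATE axis = abscissa axis (tree exact thermometer `width_iff_weilQuadratic_sobolev_subexp`):
  `rateN_iff_quasiRH` (V11 closed), `quasiRH_of_rateL2`, `rateL2_of_half_lt` (THEOREM floor),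
  `rateL2_of_quasiRH_of_sparse`, and the S8 verdict `rateN_and_strip_iff` / `quasiRH_and_strip_iff_rh`
  (RATE ∧ STRIP = abscissa partition BY THEOREM).
* §2 THRESHOLD axis: slope-1/2 negative-margin tails ARE rungs: `eventually_le_wall_iff_rung`.
* §3 PER-TEST-FUNCTION axis: one line-zeros test function carries RH: `expSum_bounded_iff_rh`, `dipole_bounded_iff_rh`.
Referee labels (g0 19:34Z / addendum): barrier note, 0 survivors; V11 CLOSED in kernel; threshold tails = rungs.

SPLITTING SEARCH over kernel-typed RH-EQUIVALENCES; a splitting A ∧ B ⟹ RH is CONDITIONAL bookkeeping unless A and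
B are both proved; nothing here bears on the truth of RH.
-/

noncomputable section

set_option linter.dupNamespace false

open Complex Filter Set MeasureTheory
open scoped Real Topology ComplexConjugate
open Literature.NumberTheory.LFunctions Literature.NumberTheory.LFunctions.WeilConverse
open Summit.RiemannHypothesis.RiemannHypothesis.Theorems
open Summit.RiemannHypothesis.RiemannHypothesis.Theorems.MotivicDoor.SemilocalThreshold (weilSemilocalThreshold)
open Summit.RiemannHypothesis.RiemannHypothesis.Theorems.WeilFormatCData.A1 (weilPositivityOn_one)

namespace Summit.RiemannHypothesis.RiemannHypothesis.Theorems.Splittings.WeilNegRungs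


/-! ## §1 The RATE axis is the abscissa axis -/

/-- **RATE_N(α) ↔ quasi-RH(α)** (the tree's exact thermometer at `Θ = 2α`): the V11 question is CLOSED. -/
theorem rateN_iff_quasiRH {α : ℝ} (hα : 0 ≤ α) : (∀ κ : ℝ, 2 * α < κ → ∃ C : ℝ, ∀ a : ℝ, 0 < a → ∀ g : ℝ → ℂ, IsWeilTest g →
      tsupport g ⊆ Icc (-a) a →
        -(C * Real.exp (κ * a)) * (weilNorm2Sq g + weilNorm2Sq (deriv g)) ≤ (weilQuadratic g).re) ↔ (∀ ρ ∈ ZetaZeros.riemannZetaNontrivialZeros, |ρ.re - 1 / 2| ≤ α) := by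
  have key := width_iff_weilQuadratic_sobolev_subexp (Θ := 2 * α) (by linarith)
  have e : 2 * α / 2 = α := by ring
  rw [e] at key
  exact key.symm

/-- RATE_{L²}(α) ⟹ quasi-RH(α) (tree, `abs_re_sub_half_le_of_weilGroundEnergy_exp_lower`). -/
theorem quasiRH_of_rateL2 {α : ℝ} (hα : 0 ≤ α) (h : (∃ C T : ℝ, ∀ a : ℝ, T ≤ a → -(C * Real.exp (2 * α * a)) ≤ weilGroundEnergy a)) : (∀ ρ ∈ ZetaZeros.riemannZetaNontrivialZeros, |ρ.re - 1 / 2| ≤ α) := by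
  obtain ⟨C, T, hCT⟩ := h
  intro ρ hρ
  have := abs_re_sub_half_le_of_weilGroundEnergy_exp_lower (κ := 2 * α) (C := C) (a₀ := T)
    (by linarith) hCT hρ
  linarith

/-- RATE_{L²}(α) is a THEOREM for every `α > 1/2` (the trivial floor `ε(a) ≥ −C(1+a)e^{a}`). -/
theorem rateL2_of_half_lt {α : ℝ} (hα : 1 / 2 < α) : (∃ C T : ℝ, ∀ a : ℝ, T ≤ a → -(C * Real.exp (2 * α * a)) ≤ weilGroundEnergy a) := by
  obtain ⟨C, hC⟩ := weilGroundEnergy_exp_lower_of_one_lt (κ := 2 * α) (by linarith)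
  exact ⟨C, 1, fun a ha ↦ hC a (by linarith)⟩

/-- quasi-RH(1/2) is a THEOREM (the open critical strip). -/
theorem quasiRH_half : (∀ ρ ∈ ZetaZeros.riemannZetaNontrivialZeros, |ρ.re - 1 / 2| ≤ (1 / 2)) := by
  intro ρ hρ
  obtain ⟨-, h0, h1⟩ := ZetaZeros.riemannZetaNontrivialZeros.mem_iff'.1 hρ
  rw [abs_le]; constructor <;> linarith

/-- Hence RATE_N(1/2) is a THEOREM as well. -/
theorem rateN_half : (∀ κ : ℝ, 2 * (1 / 2) < κ → ∃ C : ℝ, ∀ a : ℝ, 0 < a → ∀ g : ℝ → ℂ, IsWeilTest g →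
      tsupport g ⊆ Icc (-a) a →
        -(C * Real.exp (κ * a)) * (weilNorm2Sq g + weilNorm2Sq (deriv g)) ≤ (weilQuadratic g).re) := (rateN_iff_quasiRH (by norm_num)).2 quasiRH_half

/-- The `L²` converse under the sparseness rider: quasi-RH(α) ∧ SPARSE(d) ⟹ RATE_{L²}(α′) for every `α′ > α`
(tree, `weilGroundEnergy_ge_of_sparse_offline`, polynomial factor absorbed). -/
theorem rateL2_of_quasiRH_of_sparse {α α' d : ℝ} (hαα' : α < α') (hq : (∀ ρ ∈ ZetaZeros.riemannZetaNontrivialZeros, |ρ.re - 1 / 2| ≤ α)) (hd : (∀ (t : ℝ) (T : Finset ZetaZeros.riemannZetaNontrivialZeros),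
      (∀ ρ ∈ T, (ρ : ℂ).re ≠ 1 / 2 ∧ |(ρ : ℂ).im - t| ≤ 1 / 2) →
        ∑ ρ ∈ T, (riemannZetaZeroOrder (ρ : ℂ) : ℝ) ≤ d)) :
    (∃ C T : ℝ, ∀ a : ℝ, T ≤ a → -(C * Real.exp (2 * α' * a)) ≤ weilGroundEnergy a) := by
  obtain ⟨C, hC0, hC⟩ := weilGroundEnergy_ge_of_sparse_offline (Θ := 2 * α) (d := d)
    (fun ρ hρ ↦ by have := hq ρ hρ; linarith) hd
  have hδ : 0 < 2 * α' - 2 * α := by linarith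
  refine ⟨C * (1 + 1 / ((2 * α' - 2 * α) / 3)) ^ 3, 1, fun a ha ↦ ?_⟩
  have ha0 : 0 < a := by linarith
  have h1 := hC a ha0
  have h2 : (1 + a) ^ 3 * Real.exp (2 * α * a) ≤
      (1 + 1 / ((2 * α' - 2 * α) / 3)) ^ 3 * Real.exp (2 * α' * a) := by
    calc (1 + a) ^ 3 * Real.exp (2 * α * a)
        ≤ ((1 + 1 / ((2 * α' - 2 * α) / 3)) ^ 3 * Real.exp ((2 * α' - 2 * α) * a)) *
            Real.exp (2 * α * a) :=
          mul_le_mul_of_nonneg_right (one_add_pow_three_le_mul_exp hδ ha0.le) (Real.exp_pos _).le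
      _ = (1 + 1 / ((2 * α' - 2 * α) / 3)) ^ 3 * Real.exp (2 * α' * a) := by
          rw [mul_assoc, ← Real.exp_add]; congr 2; ring
  have h3 : C * ((1 + a) ^ 3 * Real.exp (2 * α * a)) ≤
      C * ((1 + 1 / ((2 * α' - 2 * α) / 3)) ^ 3 * Real.exp (2 * α' * a)) :=
    mul_le_mul_of_nonneg_left h2 hC0
  have h4 : -(C * (1 + a) ^ 3 * Real.exp (2 * α * a)) = -(C * ((1 + a) ^ 3 * Real.exp (2 * α * a))) := by ring
  have h5 : C * (1 + 1 / ((2 * α' - 2 * α) / 3)) ^ 3 * Real.exp (2 * α' * a) =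
      C * ((1 + 1 / ((2 * α' - 2 * α) / 3)) ^ 3 * Real.exp (2 * α' * a)) := by ring
  rw [h4] at h1
  rw [h5]
  linarith

/-- **The abscissa partition.** `quasi-RH(α) ∧ STRIP(α) ↔ RH` for every `α ≥ 0`. -/
theorem quasiRH_and_strip_iff_rh {α : ℝ} (hα : 0 ≤ α) : ((∀ ρ ∈ ZetaZeros.riemannZetaNontrivialZeros, |ρ.re - 1 / 2| ≤ α) ∧ (∀ ρ ∈ ZetaZeros.riemannZetaNontrivialZeros, |ρ.re - 1 / 2| ≤ α → ρ.re = 1 / 2)) ↔ _root_.RiemannHypothesis := by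
  constructor
  · rintro ⟨hq, hs⟩
    refine riemannHypothesis_iff_strip_holds.2 fun s h0s h0 h1 ↦ ?_
    have hρ := ZetaZeros.riemannZetaNontrivialZeros.mem_iff'.2 ⟨h0s, h0, h1⟩
    exact hs s hρ (hq s hρ)
  · intro hRH
    have key : ∀ ρ ∈ ZetaZeros.riemannZetaNontrivialZeros, ρ.re = 1 / 2 := fun ρ hρ ↦ by
      have h := ZetaZeros.riemannZetaNontrivialZeros.mem_iff'.1 hρ
      exact riemannHypothesis_iff_strip_holds.1 hRH ρ h.1 h.2.1 h.2.2
    exact ⟨fun ρ hρ ↦ by rw [key ρ hρ, sub_self, abs_zero]; exact hα, fun ρ hρ _ ↦ key ρ hρ⟩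

/-- **S8 in Sobolev costume IS the abscissa partition** (kernel): `RATE_N(α) ∧ STRIP(α) ↔ quasi-RH(α) ∧ STRIP(α)`. -/
theorem rateN_and_strip_iff {α : ℝ} (hα : 0 ≤ α) : ((∀ κ : ℝ, 2 * α < κ → ∃ C : ℝ, ∀ a : ℝ, 0 < a → ∀ g : ℝ → ℂ, IsWeilTest g →
      tsupport g ⊆ Icc (-a) a →
        -(C * Real.exp (κ * a)) * (weilNorm2Sq g + weilNorm2Sq (deriv g)) ≤ (weilQuadratic g).re) ∧ (∀ ρ ∈ ZetaZeros.riemannZetaNontrivialZeros, |ρ.re - 1 / 2| ≤ α → ρ.re = 1 / 2)) ↔ ((∀ ρ ∈ ZetaZeros.riemannZetaNontrivialZeros, |ρ.re - 1 / 2| ≤ α) ∧ (∀ ρ ∈ ZetaZeros.riemannZetaNontrivialZeros, |ρ.re - 1 / 2| ≤ α → ρ.re = 1 / 2)) := by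
  rw [rateN_iff_quasiRH hα]

/-- S8 (Sobolev): `RATE_N(α) → STRIP(α) → RH`. -/
theorem rh_of_rateN_strip {α : ℝ} (hα : 0 ≤ α) (hA : (∀ κ : ℝ, 2 * α < κ → ∃ C : ℝ, ∀ a : ℝ, 0 < a → ∀ g : ℝ → ℂ, IsWeilTest g →
      tsupport g ⊆ Icc (-a) a →
        -(C * Real.exp (κ * a)) * (weilNorm2Sq g + weilNorm2Sq (deriv g)) ≤ (weilQuadratic g).re)) (hB : (∀ ρ ∈ ZetaZeros.riemannZetaNontrivialZeros, |ρ.re - 1 / 2| ≤ α → ρ.re = 1 / 2)) : _root_.RiemannHypothesis :=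
  (quasiRH_and_strip_iff_rh hα).1 ⟨(rateN_iff_quasiRH hα).1 hA, hB⟩

/-- S8 (L², the g0 form): `RATE_{L²}(α) → STRIP(α) → RH`. -/
theorem rh_of_rateL2_strip {α : ℝ} (hα : 0 ≤ α) (hA : (∃ C T : ℝ, ∀ a : ℝ, T ≤ a → -(C * Real.exp (2 * α * a)) ≤ weilGroundEnergy a)) (hB : (∀ ρ ∈ ZetaZeros.riemannZetaNontrivialZeros, |ρ.re - 1 / 2| ≤ α → ρ.re = 1 / 2)) : _root_.RiemannHypothesis :=
  (quasiRH_and_strip_iff_rh hα).1 ⟨quasiRH_of_rateL2 hα hA, hB⟩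

/-- Both conjuncts are RH-implied (labels). -/
theorem quasiRH_of_rh {α : ℝ} (hα : 0 ≤ α) (h : _root_.RiemannHypothesis) : (∀ ρ ∈ ZetaZeros.riemannZetaNontrivialZeros, |ρ.re - 1 / 2| ≤ α) :=
  ((quasiRH_and_strip_iff_rh hα).2 h).1

/-- STRIP(α) is RH-implied. -/
theorem strip_of_rh {α : ℝ} (hα : 0 ≤ α) (h : _root_.RiemannHypothesis) : (∀ ρ ∈ ZetaZeros.riemannZetaNontrivialZeros, |ρ.re - 1 / 2| ≤ α → ρ.re = 1 / 2) :=
  ((quasiRH_and_strip_iff_rh hα).2 h).2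

/-- RATE_N(α) is RH-implied. -/
theorem rateN_of_rh {α : ℝ} (hα : 0 ≤ α) (h : _root_.RiemannHypothesis) : (∀ κ : ℝ, 2 * α < κ → ∃ C : ℝ, ∀ a : ℝ, 0 < a → ∀ g : ℝ → ℂ, IsWeilTest g →
      tsupport g ⊆ Icc (-a) a →
        -(C * Real.exp (κ * a)) * (weilNorm2Sq g + weilNorm2Sq (deriv g)) ≤ (weilQuadratic g).re) :=
  (rateN_iff_quasiRH hα).2 (quasiRH_of_rh hα h)

/-! ## §2 The THRESHOLD axis: slope-1/2 negative-margin tails are rungs -/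

/-- `e^{2t} < N ⟹ t < (log N)/2`. -/
private theorem lt_log_half_of_exp_lt {t : ℝ} {N : ℕ} (h : Real.exp (2 * t) < N) : t < Real.log (N : ℝ) / 2 := by
  have := Real.log_lt_log (Real.exp_pos _) h
  rw [Real.log_exp] at this
  linarith

/-- **Slope-1/2 negative margins are rungs.** For `0 < L`:
`(∃ N₀, ∀ N ≥ N₀, L ≤ a*({p < N})) ↔ WeilPositivityOn L` — i.e. the tail «`wallOffset q ≥ L − (log q)/2`
eventually» IS the finite conjunct `FIN_W(L)`, unconditionally (under `¬RH` the walls freeze at Yoshida's `a₀`,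
`HandoffDecomposition.wall_eq_threshold_of_lt`; under RH both sides hold). -/
theorem eventually_le_wall_iff_rung {L : ℝ} (hL : 0 < L) :
    (∃ N₀ : ℕ, ∀ N ≥ N₀, L ≤ weilSemilocalThreshold (Nat.primesBelow N)) ↔ WeilPositivityOn L := by
  by_cases hRH : Summit.RiemannHypothesis
  · have hW := MotivicDoor.SemilocalThreshold.riemannHypothesis_iff_forall_le_weilSemilocalThreshold.1 hRH
    refine iff_of_true ?_ (riemannHypothesis_iff_forall_weilPositivityOn.1 hRH L hL)
    obtain ⟨N₁, hN₁⟩ := exists_nat_gt (Real.exp (2 * L))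
    refine ⟨N₁ + 1, fun N hN ↦ ?_⟩
    obtain ⟨M, rfl⟩ : ∃ M, N = M + 1 := ⟨N - 1, by omega⟩
    have h1 := hW M
    have h2 : Real.exp (2 * L) < ((M + 1 : ℕ) : ℝ) := by
      have : (N₁ : ℝ) ≤ ((M + 1 : ℕ) : ℝ) := by exact_mod_cast (by omega : N₁ ≤ M + 1)
      linarith
    have h3 := lt_log_half_of_exp_lt h2
    push_cast at h3
    linarith
  · constructor
    · rintro ⟨N₀, hN₀⟩
      obtain ⟨N₁, hN₁⟩ := exists_nat_gt (Real.exp (2 * weilPositivityThreshold))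
      have hlt : weilPositivityThreshold < Real.log ((max N₀ N₁ : ℕ) : ℝ) / 2 := by
        refine lt_log_half_of_exp_lt (lt_of_lt_of_le hN₁ ?_)
        exact_mod_cast le_max_right N₀ N₁
      have h := hN₀ (max N₀ N₁) (le_max_left _ _)
      rw [HandoffDecomposition.wall_eq_threshold_of_lt hRH hlt] at h
      exact (MotivicDoor.Rungs.weilPositivityOn_iff_le_threshold hRH hL).2 h
    · intro hpos
      have hle := (MotivicDoor.Rungs.weilPositivityOn_iff_le_threshold hRH hL).1 hpos
      obtain ⟨N₁, hN₁⟩ := exists_nat_gt (Real.exp (2 * weilPositivityThreshold))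
      refine ⟨N₁, fun N hN ↦ ?_⟩
      have hlt : weilPositivityThreshold < Real.log (N : ℝ) / 2 := by
        refine lt_log_half_of_exp_lt (lt_of_lt_of_le hN₁ ?_)
        exact_mod_cast hN
      rw [HandoffDecomposition.wall_eq_threshold_of_lt hRH hlt]
      exact hle

/-- The intercept-`1` instance is a THEOREM (rung `weilPositivityOn_one`): every wall is eventually `≥ 1`
(cf. `one_le_wall_of_ge_eight`). -/
theorem eventually_one_le_wall : ∃ N₀ : ℕ, ∀ N ≥ N₀, (1 : ℝ) ≤ weilSemilocalThreshold (Nat.primesBelow N) :=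
  (eventually_le_wall_iff_rung one_pos).2 weilPositivityOn_one

/-! ## §3 The PER-TEST-FUNCTION axis: one line-zeros test function carries RH -/

/-- A line-zeros Weil test function with bounded exponential sum excludes any zero with `Re ρ > ½`
(tree dipole/exponential-sum criterion). -/
theorem false_of_expSum_bounded {g : ℝ → ℂ} (hg : IsWeilTest g) (hz : (∀ s : ℂ, weilMellin g s = 0 → s.re = 1 / 2)) {M : ℝ}
    (hM : ∀ x : ℝ, 0 ≤ x → ‖expSum g x‖ ≤ M) {ρ : ℂ} (hρ : ρ ∈ ZetaZeros.riemannZetaNontrivialZeros)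
    (hre : 1 / 2 < ρ.re) : False := by
  have hM' : ∀ x : ℝ, 0 ≤ x → ‖expSum g x‖ ≤ M * Real.exp (0 * x) := fun x hx ↦ by simpa using hM x hx
  have h := order_mul_pairCoeff_eq_zero_of_norm_expSum_le hg hM' hρ (by linarith)
  have hm : (riemannZetaZeroOrder ρ : ℂ) ≠ 0 := by
    have := ZetaZeros.riemannZetaNontrivialZeros.one_le_order hρ
    exact_mod_cast (by omega : riemannZetaZeroOrder ρ ≠ 0)
  rcases mul_eq_zero.1 h with h0 | h0
  · exact hm h0
  · unfold pairCoeff at h0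
    rcases mul_eq_zero.1 h0 with h1 | h1
    · have := hz ρ h1; linarith
    · have h2 := hz (1 - conj ρ) ((map_eq_zero _).1 h1)
      rw [one_sub_conj_re] at h2; linarith

/-- **Singleton tail.** For a line-zeros test function `g`, boundedness of its one series `B_g` on `[0, ∞)` IS RH. -/
theorem expSum_bounded_iff_rh {g : ℝ → ℂ} (hg : IsWeilTest g) (hz : (∀ s : ℂ, weilMellin g s = 0 → s.re = 1 / 2)) :
    (∃ M : ℝ, ∀ x : ℝ, 0 ≤ x → ‖expSum g x‖ ≤ M) ↔ _root_.RiemannHypothesis := by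
  constructor
  · rintro ⟨M, hM⟩
    refine riemannHypothesis_iff_strip_holds.2 fun s hs h0 h1 ↦ ?_
    have hρ := ZetaZeros.riemannZetaNontrivialZeros.mem_iff'.2 ⟨hs, h0, h1⟩
    rcases lt_trichotomy (1 / 2 : ℝ) s.re with hlt | heq | hgt
    · exact (false_of_expSum_bounded hg hz hM hρ hlt).elim
    · exact heq.symm
    · have hρ' := ZetaZeros.riemannZetaNontrivialZeros.one_sub_conj_mem hρ
      refine (false_of_expSum_bounded hg hz hM hρ' ?_).elim
      rw [one_sub_conj_re]; linarith
  · intro h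
    exact riemannHypothesis_iff_forall_expSum_bounded.1 h g hg

/-- The same singleton tail on the PRIME side: boundedness of Weil's functional along the translation dipoles
`g + c·g(· − x)` (`‖c‖ ≤ 1`, `x ≥ 0`) of ONE line-zeros test function IS RH (polarisation `two_mul_expSum_eq`). -/
theorem dipole_bounded_iff_rh {g : ℝ → ℂ} (hg : IsWeilTest g) (hz : (∀ s : ℂ, weilMellin g s = 0 → s.re = 1 / 2)) :
    (∃ M : ℝ, ∀ x : ℝ, 0 ≤ x → ∀ c : ℂ, ‖c‖ ≤ 1 → ‖weilQuadratic (translateMix g c x)‖ ≤ M) ↔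
      _root_.RiemannHypothesis := by
  constructor
  · rintro ⟨M, hM⟩
    refine (expSum_bounded_iff_rh hg hz).1 ⟨(M + 2 * ‖weilQuadratic g‖ + (M + 2 * ‖weilQuadratic g‖)) / 2,
      fun x hx ↦ ?_⟩
    have h1 := hM x hx 1 (by simp)
    have hI := hM x hx I (by simp)
    have e := two_mul_expSum_eq hg x
    have hb : ‖(2 : ℂ) * expSum g x‖ ≤ M + 2 * ‖weilQuadratic g‖ + (M + 2 * ‖weilQuadratic g‖) := by
      rw [e]
      refine (norm_sub_le _ _).trans (add_le_add ?_ ?_)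
      · refine (norm_sub_le _ _).trans ?_
        rw [norm_mul]; norm_num; linarith
      · rw [norm_mul, Complex.norm_I, one_mul]
        refine (norm_sub_le _ _).trans ?_
        rw [norm_mul]; norm_num; linarith
    have h2 : ‖(2 : ℂ) * expSum g x‖ = 2 * ‖expSum g x‖ := by rw [norm_mul]; norm_num
    linarith
  · intro h
    exact riemannHypothesis_iff_weilQuadratic_dipole_bounded.1 h g hg

end Summit.RiemannHypothesis.RiemannHypothesis.Theorems.Splittings.WeilNegRungs

end
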